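import Summits.QuantumFields.YangMills.Theorems.BalabanUVNodesSpineReadingOfRecord13CoPHChi

/-!
# THE EXTRACTION FACE AT THE χ-GENERIC SPINE READING OF RECORD IS A THEOREM — E1 ∕ E2 at `crOfRecord₁₃AtCmap Χ …` ∕ `crOfRecord₁₃VAtCmap Χ …` under the live-selector pin, (H-U),
# (H-ζ), `0 ≤ ζ`: the parents' §5 `keyedExtraction_crOfRecord₁₃(V)At` RE-PROVED at the χ-datum `datumOfRecord₁₃CoPHChi θ χ hP` (n19-d B‴ is Stage-9 ∕ datum-generic; B1 at the χ-datum
# is [Ax-3c]'s `isPrintedAveraged_datumOfRecord₁₃CoPH_chi`)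

Cell `pub-ymgap`, YM-PLAN Track A (HUMAN RULING D-0062); seat `pub-ymgap-dag-n20-d` (g45) — op 5c (b), the extraction face belonging to this lineage's reading (parents ✓p587226 §5 ∕
✓p590105 §3), supply for K3ᴬ `SpineGivenEndpointR13SepCoPHVAx` (stmt-QuantumFields-27247).  `--kind proof --supports stmt-QuantumFields-27247 --as helper`; COUNT-NEUTRAL; THEOREMS ONLY (0 `def`).
Imports T3 `…SpineReadingOfRecord13CoPHChi` (✓p806069) only; cites BY NAME n19-d B‴ `schemeZ_(succ_)eq_sum_fiber_classWeights_keyed` (`…N19TargetClassWeightsE1Keyed`, through the parent),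
[Ax-3c] `isPrintedAveraged_datumOfRecord₁₃CoPH_chi`, `ForSmallCouplings.of_forall`.  Statements and proofs = the parents', token for token under `datumOfRecord₁₃CoPH θ hP ↦
datumOfRecord₁₃CoPHChi θ χ hP`, `histA∕B₁₃ ↦ histA∕B₁₃Chi θ χ`, `keyA∕B₁₃ ↦ …Chi`, `classSet₁₃ ∕ weightA∕B₁₃ ↦ …Chi`; the live pin `hsel` keeps its FREE normalisation `E` (K3ᴬ v8 reads it
at `EOfRecord₁₃Ax`, plan g99 σ5-c).

HONEST FRAMING.  Bookkeeping over n19-d's B‴ identities; NO estimate; nothing of Bałaban's asserted, ported or discharged; no `Provisos₁₃CoPHChi` inhabitant claimed; K-Ax cruxes 3∕3 OPEN;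
N19 ∕ N20 ∕ N27 NOT discharged; counts UNMOVED (typed 28∕28 · discharged 8∕27); one finite four-torus programme at fixed `ε` — NOT ℝ⁴, NOT OS, NOT a mass gap, NOT the Clay problem.
No `def`, no `instance`, no `notation`, no `sorry`; no decl below carries a cite tag.
-/

noncomputable section

open scoped BigOperators
open Finset

namespace YMDAG.UVSplit

open Literature.MathematicalPhysics.QuantumFieldTheory.Balaban1983to89
open Literature.MathematicalPhysics.QuantumFieldTheory.Balaban1983to89.T4Continuum
open Literature.MathematicalPhysics.QuantumFieldTheory.Balaban1983to89.Node00
open Literature.MathematicalPhysics.QuantumFieldTheory.Balaban1983to89.T4ContinuumYM4Torus (ForSmallCouplings)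
open Summit.QuantumFields.BalabanUV.T4Continuum.Spine
open Summit.QuantumFields.YangMills.BalabanUVNodes.N19TargetClassWeightsE1Keyed
  (schemeZ_eq_sum_fiber_classWeights_keyed schemeZ_succ_eq_sum_fiber_classWeights_keyed)

variable {F : T4Family} {N : ℕ} [NeZero N]

/-! ## §1 E1 ∕ E2 at the χ-carriers -/

section E1E2

variable (θ : Stage13HParams F N) (χ : ChiSlot F N) (hP : θ.Provisos₁₃CoPHChi F N χ) (K₀ : ℕ) (E : B12.RunParams → ℝ)

/-- **E1 AT THE χ-CARRIERS**: for every `g₀`, `os`, `K` and EVERY source `t`, `schemeZ ((datumOfRecord₁₃CoPHChi θ χ hP).scheme g₀) os (K₀ + K) t = Σ_{x ∈ classSet₁₃Chi … K} weightA₁₃Chi … K t x`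
— n19-d B‴ §1 at the tuple's Stage-9 view and the χ-datum, run A, key `keyA₁₃Chi`. [bookkeeping] -/
theorem schemeZ_eq_sum_classSet₁₃Chi_weightA₁₃Chi (hsel : θ.ppSel = ppSelLiveOfRecord F N θ.ν θ.τ9 E (wOfRecord₉ F N θ.toStage9Params))
    (hU : LocalBgMeasurable F N θ.ν) (hζm : ZetaMeasurable F N θ.ζ) (hζ0 : ∀ p g k s Pl Ql RS U V', 0 ≤ θ.ζ p g k s Pl Ql RS U V')
    (g₀ : ℕ → ℝ) (os : List (ULoop F)) (K : ℕ) (t : ℝ) :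
    T4GenFunBounds.schemeZ ((datumOfRecord₁₃CoPHChi F N θ χ hP).scheme g₀) os (K₀ + K) t =
      ∑ x ∈ classSet₁₃Chi θ χ K₀ g₀ K, weightA₁₃Chi θ χ hP K₀ g₀ os K t x := by
  letI : ∀ Kc, DecidableEq (SiteSeqKey F Kc) := fun _ => Classical.decEq _
  by_cases ht : |t| ≤ 1
  · exact schemeZ_eq_sum_fiber_classWeights_keyed θ.toStage9Params E hsel hU hζm hζ0 hP.zetaAbs hP.zetaUnity (datumOfRecord₁₃CoPHChi F N θ χ hP)
      (isPrintedAveraged_datumOfRecord₁₃CoPH_chi F N θ χ hP).avgMeasurable g₀ os (K₀ := K₀) (runA₁₃ F K₀ g₀) (histA₁₃Chi θ χ K₀ g₀) (fun _ => rfl)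
      (histA₁₃Chi_zero θ χ K₀ g₀) (classSet₁₃Chi θ χ K₀ g₀) (keyA₁₃Chi θ χ K₀ g₀)
      (fun K s => Finset.mem_union_left _ (Finset.mem_image_of_mem _ (Finset.mem_univ s))) 1 K t ht
  · exact schemeZ_eq_sum_fiber_classWeights_keyed θ.toStage9Params E hsel hU hζm hζ0 hP.zetaAbs hP.zetaUnity (datumOfRecord₁₃CoPHChi F N θ χ hP)
      (isPrintedAveraged_datumOfRecord₁₃CoPH_chi F N θ χ hP).avgMeasurable g₀ os (K₀ := K₀) (runA₁₃ F K₀ g₀) (histA₁₃Chi θ χ K₀ g₀) (fun _ => rfl)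
      (histA₁₃Chi_zero θ χ K₀ g₀) (classSet₁₃Chi θ χ K₀ g₀) (keyA₁₃Chi θ χ K₀ g₀)
      (fun K s => Finset.mem_union_left _ (Finset.mem_image_of_mem _ (Finset.mem_univ s))) |t| K t le_rfl

/-- **E2 AT THE χ-CARRIERS**: `schemeZ (…) os (K₀ + K + 1) t = Σ_{x ∈ classSet₁₃Chi … K} weightB₁₃Chi … K t x` — B‴ §1, run B, key `keyB₁₃Chi`. [bookkeeping] -/
theorem schemeZ_succ_eq_sum_classSet₁₃Chi_weightB₁₃Chi (hsel : θ.ppSel = ppSelLiveOfRecord F N θ.ν θ.τ9 E (wOfRecord₉ F N θ.toStage9Params))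
    (hU : LocalBgMeasurable F N θ.ν) (hζm : ZetaMeasurable F N θ.ζ) (hζ0 : ∀ p g k s Pl Ql RS U V', 0 ≤ θ.ζ p g k s Pl Ql RS U V')
    (g₀ : ℕ → ℝ) (os : List (ULoop F)) (K : ℕ) (t : ℝ) :
    T4GenFunBounds.schemeZ ((datumOfRecord₁₃CoPHChi F N θ χ hP).scheme g₀) os (K₀ + K + 1) t =
      ∑ x ∈ classSet₁₃Chi θ χ K₀ g₀ K, weightB₁₃Chi θ χ hP K₀ g₀ os K t x := by
  letI : ∀ Kc, DecidableEq (SiteSeqKey F Kc) := fun _ => Classical.decEq _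
  exact schemeZ_succ_eq_sum_fiber_classWeights_keyed θ.toStage9Params E hsel hU hζm hζ0 hP.zetaAbs hP.zetaUnity (datumOfRecord₁₃CoPHChi F N θ χ hP)
    (isPrintedAveraged_datumOfRecord₁₃CoPH_chi F N θ χ hP).avgMeasurable g₀ os (K₀ := K₀) (runB₁₃ F K₀ g₀) (histB₁₃Chi θ χ K₀ g₀) (fun _ => rfl)
    (histB₁₃Chi_zero θ χ K₀ g₀) (classSet₁₃Chi θ χ K₀ g₀) (keyB₁₃Chi θ χ K₀ g₀)
    (fun K s' => Finset.mem_union_right _ (Finset.mem_image_of_mem _ (Finset.mem_univ s'))) |t| K t le_rfl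

end E1E2

/-! ## §2 The extraction face at the χ-readings -/

section Extraction

variable (Χ : (F : T4Family) → Stage13Params F N → ChiSlot F N) (K₀ : ℕ) (jcut : ℕ → ℕ) (sh : ShellSplit₁₃CoPHCmap N Χ K₀) (θ : Stage13HParams F N)
  (hP : θ.Provisos₁₃CoPHChi F N (Χ F θ.toStage13Params)) (E : B12.RunParams → ℝ)

/-- ★★ **THE EXTRACTION FACE AT THE χ-READING IS A THEOREM** (`KeyedExtraction`-shape restricted to the tuple, under the live-selector pin and the three laws; the conclusion holds
for EVERY `g₀`, so `ForSmallCouplings` by `of_forall`). [bookkeeping] -/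
theorem keyedExtraction_crOfRecord₁₃AtCmap (hsel : θ.ppSel = ppSelLiveOfRecord F N θ.ν θ.τ9 E (wOfRecord₉ F N θ.toStage9Params))
    (hU : LocalBgMeasurable F N θ.ν) (hζm : ZetaMeasurable F N θ.ζ) (hζ0 : ∀ p g k s Pl Ql RS U V', 0 ≤ θ.ζ p g k s Pl Ql RS U V') :
    ForSmallCouplings (datumOfRecord₁₃CoPHChi F N θ (Χ F θ.toStage13Params) hP) fun g₀ => ∀ os : List (ULoop F),
      0 < (crOfRecord₁₃AtCmap Χ K₀ jcut sh F θ hP g₀ os).l₀ ∧ 0 < (crOfRecord₁₃AtCmap Χ K₀ jcut sh F θ hP g₀ os).vol ∧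
      (∀ (K : ℕ) (t : ℝ), |t| ≤ (crOfRecord₁₃AtCmap Χ K₀ jcut sh F θ hP g₀ os).l₀ →
        T4GenFunBounds.schemeZ ((datumOfRecord₁₃CoPHChi F N θ (Χ F θ.toStage13Params) hP).scheme g₀) os ((crOfRecord₁₃AtCmap Χ K₀ jcut sh F θ hP g₀ os).K₀ + K) t =
          ∑ τ ∈ (crOfRecord₁₃AtCmap Χ K₀ jcut sh F θ hP g₀ os).T K, (crOfRecord₁₃AtCmap Χ K₀ jcut sh F θ hP g₀ os).A K t τ) ∧
      (∀ (K : ℕ) (t : ℝ), |t| ≤ (crOfRecord₁₃AtCmap Χ K₀ jcut sh F θ hP g₀ os).l₀ →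
        T4GenFunBounds.schemeZ ((datumOfRecord₁₃CoPHChi F N θ (Χ F θ.toStage13Params) hP).scheme g₀) os ((crOfRecord₁₃AtCmap Χ K₀ jcut sh F θ hP g₀ os).K₀ + K + 1) t =
          ∑ τ ∈ (crOfRecord₁₃AtCmap Χ K₀ jcut sh F θ hP g₀ os).T K, (crOfRecord₁₃AtCmap Χ K₀ jcut sh F θ hP g₀ os).B K t τ) :=
  ForSmallCouplings.of_forall fun g₀ os =>
    ⟨one_pos, one_pos, fun K t _ => schemeZ_eq_sum_classSet₁₃Chi_weightA₁₃Chi θ (Χ F θ.toStage13Params) hP K₀ E hsel hU hζm hζ0 g₀ os K t,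
      fun K t _ => schemeZ_succ_eq_sum_classSet₁₃Chi_weightB₁₃Chi θ (Χ F θ.toStage13Params) hP K₀ E hsel hU hζm hζ0 g₀ os K t⟩

/-- ★★ **THE EXTRACTION FACE AT THE χ-READING, PHYSICAL VOLUME LETTER** (`0 < vol = F.side ^ 4`). [bookkeeping] -/
theorem keyedExtraction_crOfRecord₁₃VAtCmap (hsel : θ.ppSel = ppSelLiveOfRecord F N θ.ν θ.τ9 E (wOfRecord₉ F N θ.toStage9Params))
    (hU : LocalBgMeasurable F N θ.ν) (hζm : ZetaMeasurable F N θ.ζ) (hζ0 : ∀ p g k s Pl Ql RS U V', 0 ≤ θ.ζ p g k s Pl Ql RS U V') :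
    ForSmallCouplings (datumOfRecord₁₃CoPHChi F N θ (Χ F θ.toStage13Params) hP) fun g₀ => ∀ os : List (ULoop F),
      0 < (crOfRecord₁₃VAtCmap Χ K₀ jcut sh F θ hP g₀ os).l₀ ∧ 0 < (crOfRecord₁₃VAtCmap Χ K₀ jcut sh F θ hP g₀ os).vol ∧
      (∀ (K : ℕ) (t : ℝ), |t| ≤ (crOfRecord₁₃VAtCmap Χ K₀ jcut sh F θ hP g₀ os).l₀ →
        T4GenFunBounds.schemeZ ((datumOfRecord₁₃CoPHChi F N θ (Χ F θ.toStage13Params) hP).scheme g₀) os ((crOfRecord₁₃VAtCmap Χ K₀ jcut sh F θ hP g₀ os).K₀ + K) t =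
          ∑ τ ∈ (crOfRecord₁₃VAtCmap Χ K₀ jcut sh F θ hP g₀ os).T K, (crOfRecord₁₃VAtCmap Χ K₀ jcut sh F θ hP g₀ os).A K t τ) ∧
      (∀ (K : ℕ) (t : ℝ), |t| ≤ (crOfRecord₁₃VAtCmap Χ K₀ jcut sh F θ hP g₀ os).l₀ →
        T4GenFunBounds.schemeZ ((datumOfRecord₁₃CoPHChi F N θ (Χ F θ.toStage13Params) hP).scheme g₀) os ((crOfRecord₁₃VAtCmap Χ K₀ jcut sh F θ hP g₀ os).K₀ + K + 1) t =
          ∑ τ ∈ (crOfRecord₁₃VAtCmap Χ K₀ jcut sh F θ hP g₀ os).T K, (crOfRecord₁₃VAtCmap Χ K₀ jcut sh F θ hP g₀ os).B K t τ) :=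
  ForSmallCouplings.of_forall fun g₀ os =>
    ⟨one_pos, pow_pos F.side_pos 4, fun K t _ => schemeZ_eq_sum_classSet₁₃Chi_weightA₁₃Chi θ (Χ F θ.toStage13Params) hP K₀ E hsel hU hζm hζ0 g₀ os K t,
      fun K t _ => schemeZ_succ_eq_sum_classSet₁₃Chi_weightB₁₃Chi θ (Χ F θ.toStage13Params) hP K₀ E hsel hU hζm hζ0 g₀ os K t⟩

end Extraction

end YMDAG.UVSplit

end
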